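/-
Copyright (c) 2026. All rights reserved.
Released under Apache 2.0 license as described in the file LICENSE.
-/
import Literature.NumberTheory.Automorphic.MaximalOrderDiscSevenLattice
import HarnessLib

/-!
# Small representation numbers of the norm form `Q₇ = a² + ac + 2c² + b² + bd + 2d²` of the maximal order `O₇` of
# `(−1,−7 ∣ ℚ)`: `r₇(2) = 12`, `r₇(3) = 16`, `r₇(4) = 28`, `r₇(5) = 24`, `r₇(6) = 48`, `r₇(8) = 60`, `r₇(9) = 52`, `r₇(16) = 124`
# — certified box counts, all equal to `4(σ(n) − 7σ(n/7))`

[tag: quaternion_algebra] [tag: quadratic_form] [tag: brandt_matrix]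

Topic `NumberTheory/Automorphic`; THEOREMS ONLY (no definition, no named fact, no instance; net Literature debt `0`).
Lane `lit-hodgefound`, seat p12, gen 46 — a file of the series on the definite quaternion order of discriminant `7`, the `D = 7`
counterpart of `MaximalOrderDiscFiveNormsSmall`.

`MaximalOrderDiscSevenLattice` identified `#{x ∈ O₇ : nrd x = n}` with the number `r₇(n)` of integer solutions of `Q₇ = n`
(`natCard_reducedNorm_eq_natCard_form`) and computed `r₇(1) = 4`; `MaximalOrderDiscSevenNormsSevenMul` gave `r₇(7ᵃm) = r₇(m)`.
Eichler's theory predicts, once `# Cls O₇ = 1` is known (Voight Exercise 17.10 (a), Thm. 25.4.1; in the tree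
`MaximalOrderDiscSevenClassNumberOne`), that `r₇(n) = 2w·T(n) = 4·Σ_{d ∣ n, 7 ∤ d} d = 4σ(n) − 28σ(n/7)` (row sums `σ(n)` of
`B(n)` for `(n, 7) = 1`, LNM 320 II §6 Cor. 1; `B(7ᵃ) = 1`); equivalently the theta series of `O₇` is the Eisenstein series of
weight `2` and level `7` (`M₂(Γ₀(7))` is one-dimensional). This file CERTIFIES the first values by enumeration — independently of
the class number — after confining the solutions of `Q₇ = n` to a box (`8Q₇ = (a+4c)² + 7a² + (b+4d)² + 7b²` and
`4Q₇ = (2a+c)² + 7c² + (2b+d)² + 7d²`, so `7a², 7b² ≤ 8n` and `7c², 7d² ≤ 4n`):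

* §1 `eight_mul_form_eq`, `four_mul_form_eq` (the sum-of-squares identities), `sq_le_of_form_eq`
  (`7a² ≤ 8n ∧ 7b² ≤ 8n ∧ 7c² ≤ 4n ∧ 7d² ≤ 4n`), **`natCard_form_eq_card_filter_box`** (the count is the box count over
  `[−B₁,B₁]×[−B₂,B₂]×[−B₃,B₃]×[−B₄,B₄]` whenever `8n < 7(B₁+1)²`, `8n < 7(B₂+1)²`, `4n < 7(B₃+1)²`, `4n < 7(B₄+1)²`);
* §2 **`natCard_form_two`** (`12 = 4·3`), **`natCard_form_three`** (`16 = 4·4`), **`natCard_form_four`** (`28 = 4·7`),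
  **`natCard_form_five`** (`24 = 4·6`), **`natCard_form_six`** (`48 = 4·12`), **`natCard_form_eight`** (`60 = 4·15`),
  **`natCard_form_nine`** (`52 = 4·13`), **`natCard_form_sixteen`** (`124 = 4·31`) — by `decide +kernel` on boxes of at most
  `9·9·7·7` points; `sigma_values` (`σ` at `2, 3, 4, 5, 6, 8, 9, 16`), and for `O₇`: `natCard_reducedNorm_two`, `_three`, `_four`.

## Sources

* M. Eichler, LNM 320 (1973), Ch. II §6 Thm. 2 (18)–(19) and Cor. 1 (row sums `σ(n)` of the Brandt matrices for `(n, D) = 1`;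
  the recursion at split primes), §2. [cite: Eichler1973, Ch. II §6 Thm. 2 (18)–(19) and Cor. 1]
* J. Voight, *Quaternion Algebras*, GTM 288 (2021), Exercise 17.10 ((a) `# Cls O = 1` for discriminant `7`; (b) the quaternary
  form `t² + tz + x² + xy + 2y² + 2z²` is multiplicative and universal), Thm. 25.1.1 (mass `1/2`), Thm. 25.4.1.
  [cite: Voight2021, Exercise 17.10; Thm. 25.4.1]

## Scope (honest)

Theorems only. Eight individual values by certified enumeration; the closed formula `r₇(n) = 4σ(n) − 28σ(n/7)` for all `n`
needs `# Cls O₇ = 1` together with the Hecke theory of the Brandt matrices at the split primes, which is not invoked here.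
-/

open Quaternion
open Finset

namespace Literature.NumberTheory.Automorphic.MaxOrderDiscSeven

/-! ## §1 The solutions of `Q₇ = n` lie in a box -/

section Box

/-- `8·Q₇(a,b,c,d) = (a + 4c)² + 7a² + (b + 4d)² + 7b²`. [cite: Voight2021, Exercise 17.10 (b)] -/
theorem eight_mul_form_eq (a b c d : ℤ) :
    8 * (a ^ 2 + a * c + 2 * c ^ 2 + b ^ 2 + b * d + 2 * d ^ 2) =
      (a + 4 * c) ^ 2 + 7 * a ^ 2 + (b + 4 * d) ^ 2 + 7 * b ^ 2 := by
  ring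

/-- `4·Q₇(a,b,c,d) = (2a + c)² + 7c² + (2b + d)² + 7d²`. [cite: Voight2021, Exercise 17.10 (b)] -/
theorem four_mul_form_eq (a b c d : ℤ) :
    4 * (a ^ 2 + a * c + 2 * c ^ 2 + b ^ 2 + b * d + 2 * d ^ 2) =
      (2 * a + c) ^ 2 + 7 * c ^ 2 + (2 * b + d) ^ 2 + 7 * d ^ 2 := by
  ring

/-- `Q₇(a,b,c,d) = n ⟹ 7a² ≤ 8n ∧ 7b² ≤ 8n ∧ 7c² ≤ 4n ∧ 7d² ≤ 4n`. [cite: Voight2021, Exercise 17.10 (b)] -/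
theorem sq_le_of_form_eq {a b c d n : ℤ} (h : a ^ 2 + a * c + 2 * c ^ 2 + b ^ 2 + b * d + 2 * d ^ 2 = n) :
    7 * a ^ 2 ≤ 8 * n ∧ 7 * b ^ 2 ≤ 8 * n ∧ 7 * c ^ 2 ≤ 4 * n ∧ 7 * d ^ 2 ≤ 4 * n := by
  have h8 := eight_mul_form_eq a b c d
  have h4 := four_mul_form_eq a b c d
  rw [h] at h8 h4
  refine ⟨?_, ?_, ?_, ?_⟩
  · nlinarith [sq_nonneg (a + 4 * c), sq_nonneg (b + 4 * d), sq_nonneg b]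
  · nlinarith [sq_nonneg (a + 4 * c), sq_nonneg (b + 4 * d), sq_nonneg a]
  · nlinarith [sq_nonneg (2 * a + c), sq_nonneg (2 * b + d), sq_nonneg d]
  · nlinarith [sq_nonneg (2 * a + c), sq_nonneg (2 * b + d), sq_nonneg c]

/-- `k·x² ≤ m`, `m < k·(B+1)²`, `0 < k`, `0 ≤ B` ⟹ `−B ≤ x ≤ B`. [folklore] -/
private theorem abs_le_of_mul_sq_le {x m B k : ℤ} (hk : 0 < k) (hB : 0 ≤ B) (hx : k * x ^ 2 ≤ m) (hm : m < k * (B + 1) ^ 2) :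
    -B ≤ x ∧ x ≤ B := by
  have h : x ^ 2 < (B + 1) ^ 2 := lt_of_mul_lt_mul_left (lt_of_le_of_lt hx hm) hk.le
  have habs : |x| < B + 1 := abs_lt_of_sq_lt_sq h (by linarith)
  obtain ⟨h1, h2⟩ := abs_lt.1 habs
  constructor <;> omega

/-- **The representation count is a finite box count:** if `8n < 7(B₁+1)²`, `8n < 7(B₂+1)²`, `4n < 7(B₃+1)²`, `4n < 7(B₄+1)²`
then the solutions of `Q₇ = n` are exactly those in the box `[−B₁,B₁] × [−B₂,B₂] × [−B₃,B₃] × [−B₄,B₄]`. [cite: Voight2021, Exercise 17.10 (b)] -/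
theorem natCard_form_eq_card_filter_box (n B₁ B₂ B₃ B₄ : ℤ) (hB₁ : 0 ≤ B₁) (hB₂ : 0 ≤ B₂) (hB₃ : 0 ≤ B₃) (hB₄ : 0 ≤ B₄)
    (h₁ : 8 * n < 7 * (B₁ + 1) ^ 2) (h₂ : 8 * n < 7 * (B₂ + 1) ^ 2) (h₃ : 4 * n < 7 * (B₃ + 1) ^ 2)
    (h₄ : 4 * n < 7 * (B₄ + 1) ^ 2) :
    Nat.card {v : ℤ × ℤ × ℤ × ℤ // v.1 ^ 2 + v.1 * v.2.2.1 + 2 * v.2.2.1 ^ 2 + v.2.1 ^ 2 + v.2.1 * v.2.2.2 + 2 * v.2.2.2 ^ 2 = n} =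
      ((Icc (-B₁) B₁ ×ˢ Icc (-B₂) B₂ ×ˢ Icc (-B₃) B₃ ×ˢ Icc (-B₄) B₄).filter
        fun v : ℤ × ℤ × ℤ × ℤ => v.1 ^ 2 + v.1 * v.2.2.1 + 2 * v.2.2.1 ^ 2 + v.2.1 ^ 2 + v.2.1 * v.2.2.2 + 2 * v.2.2.2 ^ 2 = n).card := by
  have hS : {v : ℤ × ℤ × ℤ × ℤ | v.1 ^ 2 + v.1 * v.2.2.1 + 2 * v.2.2.1 ^ 2 + v.2.1 ^ 2 + v.2.1 * v.2.2.2 + 2 * v.2.2.2 ^ 2 = n} =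
      ↑((Icc (-B₁) B₁ ×ˢ Icc (-B₂) B₂ ×ˢ Icc (-B₃) B₃ ×ˢ Icc (-B₄) B₄).filter
        fun v : ℤ × ℤ × ℤ × ℤ => v.1 ^ 2 + v.1 * v.2.2.1 + 2 * v.2.2.1 ^ 2 + v.2.1 ^ 2 + v.2.1 * v.2.2.2 + 2 * v.2.2.2 ^ 2 = n) := by
    ext ⟨a, b, c, d⟩
    simp only [Set.mem_setOf_eq, coe_filter, mem_Icc, mem_product]
    constructor
    · intro h
      obtain ⟨ha, hb, hc, hd⟩ := sq_le_of_form_eq h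
      exact ⟨⟨abs_le_of_mul_sq_le (by norm_num) hB₁ ha h₁, abs_le_of_mul_sq_le (by norm_num) hB₂ hb h₂,
        abs_le_of_mul_sq_le (by norm_num) hB₃ hc h₃, abs_le_of_mul_sq_le (by norm_num) hB₄ hd h₄⟩, h⟩
    · exact And.right
  rw [← Set.ncard_coe_finset, ← hS]
  exact Nat.card_coe_set_eq _

end Box

/-! ## §2 `r₇(2) = 12`, `r₇(3) = 16`, `r₇(4) = 28`, `r₇(5) = 24`, `r₇(6) = 48`, `r₇(8) = 60`, `r₇(9) = 52`, `r₇(16) = 124` -/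

section Counts

/-- **`r₇(2) = 12 = 4σ(2)`**. [cite: Eichler1973, Ch. II §6 Thm. 2 Cor. 1] [cite: Voight2021, Exercise 17.10] -/
theorem natCard_form_two :
    Nat.card {v : ℤ × ℤ × ℤ × ℤ // v.1 ^ 2 + v.1 * v.2.2.1 + 2 * v.2.2.1 ^ 2 + v.2.1 ^ 2 + v.2.1 * v.2.2.2 + 2 * v.2.2.2 ^ 2 = 2} = 12 := by
  rw [natCard_form_eq_card_filter_box 2 1 1 1 1 (by norm_num) (by norm_num) (by norm_num) (by norm_num) (by norm_num) (by norm_num)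
    (by norm_num) (by norm_num)]
  decide +kernel

/-- **`r₇(3) = 16 = 4σ(3)`**. [cite: Eichler1973, Ch. II §6 Thm. 2 Cor. 1] [cite: Voight2021, Exercise 17.10] -/
theorem natCard_form_three :
    Nat.card {v : ℤ × ℤ × ℤ × ℤ // v.1 ^ 2 + v.1 * v.2.2.1 + 2 * v.2.2.1 ^ 2 + v.2.1 ^ 2 + v.2.1 * v.2.2.2 + 2 * v.2.2.2 ^ 2 = 3} = 16 := by
  rw [natCard_form_eq_card_filter_box 3 1 1 1 1 (by norm_num) (by norm_num) (by norm_num) (by norm_num) (by norm_num) (by norm_num)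
    (by norm_num) (by norm_num)]
  decide +kernel

/-- **`r₇(4) = 28 = 4σ(4)`** (a non-squarefree value: `T(4) = 7 = T(2)² − 2`, Eichler's recursion at the split prime `2`). [cite: Eichler1973, Ch. II §6 Thm. 2 (19) and Cor. 1] -/
theorem natCard_form_four :
    Nat.card {v : ℤ × ℤ × ℤ × ℤ // v.1 ^ 2 + v.1 * v.2.2.1 + 2 * v.2.2.1 ^ 2 + v.2.1 ^ 2 + v.2.1 * v.2.2.2 + 2 * v.2.2.2 ^ 2 = 4} = 28 := by
  rw [natCard_form_eq_card_filter_box 4 2 2 1 1 (by norm_num) (by norm_num) (by norm_num) (by norm_num) (by norm_num) (by norm_num)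
    (by norm_num) (by norm_num)]
  decide +kernel

/-- **`r₇(5) = 24 = 4σ(5)`**. [cite: Eichler1973, Ch. II §6 Thm. 2 Cor. 1] [cite: Voight2021, Exercise 17.10] -/
theorem natCard_form_five :
    Nat.card {v : ℤ × ℤ × ℤ × ℤ // v.1 ^ 2 + v.1 * v.2.2.1 + 2 * v.2.2.1 ^ 2 + v.2.1 ^ 2 + v.2.1 * v.2.2.2 + 2 * v.2.2.2 ^ 2 = 5} = 24 := by
  rw [natCard_form_eq_card_filter_box 5 2 2 1 1 (by norm_num) (by norm_num) (by norm_num) (by norm_num) (by norm_num) (by norm_num)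
    (by norm_num) (by norm_num)]
  decide +kernel

/-- **`r₇(6) = 48 = 4σ(6)`** (`= r₇(2)r₇(3)/4`: multiplicativity). [cite: Eichler1973, Ch. II §6 Thm. 2 (18) and Cor. 1] -/
theorem natCard_form_six :
    Nat.card {v : ℤ × ℤ × ℤ × ℤ // v.1 ^ 2 + v.1 * v.2.2.1 + 2 * v.2.2.1 ^ 2 + v.2.1 ^ 2 + v.2.1 * v.2.2.2 + 2 * v.2.2.2 ^ 2 = 6} = 48 := by
  rw [natCard_form_eq_card_filter_box 6 2 2 1 1 (by norm_num) (by norm_num) (by norm_num) (by norm_num) (by norm_num) (by norm_num)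
    (by norm_num) (by norm_num)]
  decide +kernel

/-- **`r₇(8) = 60 = 4σ(8)`** (`T(8) = 15 = T(2)T(4) − 2T(2)`). [cite: Eichler1973, Ch. II §6 Thm. 2 (19) and Cor. 1] -/
theorem natCard_form_eight :
    Nat.card {v : ℤ × ℤ × ℤ × ℤ // v.1 ^ 2 + v.1 * v.2.2.1 + 2 * v.2.2.1 ^ 2 + v.2.1 ^ 2 + v.2.1 * v.2.2.2 + 2 * v.2.2.2 ^ 2 = 8} = 60 := by
  rw [natCard_form_eq_card_filter_box 8 3 3 2 2 (by norm_num) (by norm_num) (by norm_num) (by norm_num) (by norm_num) (by norm_num)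
    (by norm_num) (by norm_num)]
  decide +kernel

/-- **`r₇(9) = 52 = 4σ(9)`** (`T(9) = 13 = T(3)² − 3`, Eichler's recursion at the split prime `3`). [cite: Eichler1973, Ch. II §6 Thm. 2 (19) and Cor. 1] -/
theorem natCard_form_nine :
    Nat.card {v : ℤ × ℤ × ℤ × ℤ // v.1 ^ 2 + v.1 * v.2.2.1 + 2 * v.2.2.1 ^ 2 + v.2.1 ^ 2 + v.2.1 * v.2.2.2 + 2 * v.2.2.2 ^ 2 = 9} = 52 := by
  rw [natCard_form_eq_card_filter_box 9 3 3 2 2 (by norm_num) (by norm_num) (by norm_num) (by norm_num) (by norm_num) (by norm_num)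
    (by norm_num) (by norm_num)]
  decide +kernel

/-- **`r₇(16) = 124 = 4σ(16)`** (`T(16) = 31 = T(2)T(8) − 2T(4)`). [cite: Eichler1973, Ch. II §6 Thm. 2 (19) and Cor. 1] -/
theorem natCard_form_sixteen :
    Nat.card {v : ℤ × ℤ × ℤ × ℤ // v.1 ^ 2 + v.1 * v.2.2.1 + 2 * v.2.2.1 ^ 2 + v.2.1 ^ 2 + v.2.1 * v.2.2.2 + 2 * v.2.2.2 ^ 2 = 16} = 124 := by
  rw [natCard_form_eq_card_filter_box 16 4 4 3 3 (by norm_num) (by norm_num) (by norm_num) (by norm_num) (by norm_num) (by norm_num)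
    (by norm_num) (by norm_num)]
  decide +kernel

/-- The divisor sums behind the eight values: `σ(2), σ(3), σ(4), σ(5), σ(6), σ(8), σ(9), σ(16) = 3, 4, 7, 6, 12, 15, 13, 31`.
[cite: Eichler1973, Ch. II §6 Thm. 2 Cor. 1] -/
theorem sigma_values :
    ArithmeticFunction.sigma 1 2 = 3 ∧ ArithmeticFunction.sigma 1 3 = 4 ∧ ArithmeticFunction.sigma 1 4 = 7 ∧
      ArithmeticFunction.sigma 1 5 = 6 ∧ ArithmeticFunction.sigma 1 6 = 12 ∧ ArithmeticFunction.sigma 1 8 = 15 ∧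
        ArithmeticFunction.sigma 1 9 = 13 ∧ ArithmeticFunction.sigma 1 16 = 31 := by
  refine ⟨?_, ?_, ?_, ?_, ?_, ?_, ?_, ?_⟩ <;> decide +kernel

/-- **`#{x ∈ O₇ : nrd x = 2} = 12`.** [cite: Eichler1973, Ch. II §6 Thm. 2 Cor. 1] [cite: Voight2021, Exercise 17.10] -/
theorem natCard_reducedNorm_two : Nat.card {x : ℍ[ℚ,-1,-7] // x ∈ (Submodule.span ℤ (Set.range ![(⟨1, 0, 0, 0⟩ : ℍ[ℚ,-1,-7]), ⟨0, 1, 0, 0⟩, ⟨1/2, 0, 1/2, 0⟩, ⟨0, 1/2, 0, 1/2⟩])) ∧ reducedNorm ℚ ℍ[ℚ,-1,-7] x = (2 : ℕ)} = 12 := by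
  have h := natCard_reducedNorm_eq_natCard_form ((2 : ℕ) : ℤ)
  push_cast at h ⊢
  rw [h]
  exact natCard_form_two

/-- **`#{x ∈ O₇ : nrd x = 3} = 16`.** [cite: Eichler1973, Ch. II §6 Thm. 2 Cor. 1] [cite: Voight2021, Exercise 17.10] -/
theorem natCard_reducedNorm_three : Nat.card {x : ℍ[ℚ,-1,-7] // x ∈ (Submodule.span ℤ (Set.range ![(⟨1, 0, 0, 0⟩ : ℍ[ℚ,-1,-7]), ⟨0, 1, 0, 0⟩, ⟨1/2, 0, 1/2, 0⟩, ⟨0, 1/2, 0, 1/2⟩])) ∧ reducedNorm ℚ ℍ[ℚ,-1,-7] x = (3 : ℕ)} = 16 := by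
  have h := natCard_reducedNorm_eq_natCard_form ((3 : ℕ) : ℤ)
  push_cast at h ⊢
  rw [h]
  exact natCard_form_three

/-- **`#{x ∈ O₇ : nrd x = 4} = 28`.** [cite: Eichler1973, Ch. II §6 Thm. 2 (19) and Cor. 1] -/
theorem natCard_reducedNorm_four : Nat.card {x : ℍ[ℚ,-1,-7] // x ∈ (Submodule.span ℤ (Set.range ![(⟨1, 0, 0, 0⟩ : ℍ[ℚ,-1,-7]), ⟨0, 1, 0, 0⟩, ⟨1/2, 0, 1/2, 0⟩, ⟨0, 1/2, 0, 1/2⟩])) ∧ reducedNorm ℚ ℍ[ℚ,-1,-7] x = (4 : ℕ)} = 28 := by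
  have h := natCard_reducedNorm_eq_natCard_form ((4 : ℕ) : ℤ)
  push_cast at h ⊢
  rw [h]
  exact natCard_form_four

end Counts

end Literature.NumberTheory.Automorphic.MaxOrderDiscSeven
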